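import Literature.MathematicalPhysics.QuantumFieldTheory.Balaban1983to89.B16StepFactorsPrinted
import Literature.MathematicalPhysics.QuantumFieldTheory.Balaban1983to89.B16Cor3

/-!
# `Balaban1983to89.B16Carve40BoundsCor3Hyp` — [Balaban1989LargeFieldII] pp. 380–392 [PDF 26–38] (Sect. 1, (1.73)–(1.104):
# the large-field bounds (1.73)–(1.79), the inductive statement (1.80)–(1.88), the fundamental inequality (1.89) and Corollary 3,
# the exponentiated cluster expansion (1.90)–(1.100), the new action (1.101)–(1.102), the end of the proof of Theorem 1, the
# final remark (1.103)–(1.104)): THE HYPOTHESIS-FORM BUNDLE OF CARVING BLOCK 40, keyed to `B16.Construction`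

statement-level skeleton of published theorems with citation tags; proofs where landed; nothing here is a claim about the
Yang–Mills mass gap

SOURCE.  T. Bałaban, *Large field renormalization. II. Localization, exponentiation, and bounds for the 𝐑 operation*,
Commun. Math. Phys. **122** (1989) 355–392, doi:10.1007/bf01238433 [`Balaban1989LargeFieldII`] (cell paper "B16" = [V] of the
1983–89 lattice Yang–Mills series; held `paper:balaban1989-cmp122-large-field-ii`, journal page = PDF page + 354; its [I]–[IV] =
[Balaban1987RG1], [Balaban1988RG2Cluster], [Balaban1988Convergent], [Balaban1989LargeFieldI] = cell B12–B15).  Pages 379–392 were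
read first-hand for this file on the page renders `run/shared/lean/pub/pub-balaban/b2b-balaban-ref1/pages/1989-cmp122-large-field-II/
…-p025-x2.png` … `…-p038-x2.png` (every display) AND on the text layer (`lit read … --pages 26-38`, which garbles the displays).
STATUS of the source: published, refereed; the series' end statement is a CLAIM UNDER ADJUDICATION by the audit cell `pub-balaban`
(0∕13 main theorems of the series proved in the tree) — see `…B16`'s module docstring.

WHY THIS FILE (cell `lit-balaban`, P6 CARVING FAN of D-0154 (3b); seat `lit-balaban-carve-09` g3, assigned block 40 by the cell
lead's RULING #7 (`run/shared/lean/pub/lit-balaban/carve/STATUS.md` 2026-08-28T06:52:11Z); block row 40 of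
`carve/BLOCKS-31-40.md` v1.1∕v1.2 = `carve/CARVE-LIST.md` §4 Block 40, rules `carve/CARVE-RULES.md`; KEY item
`stmt-QuantumFields-20542` (K1⁷ `StabilityBAtRecordR13SepCoPH`, DAG lane n13 [B16]; its conclusion carries
`B16.EndStatementBPrinted (Node00.datumOfRecord₁₃SepCoPH …).C`), also-feeds `stmt-QuantumFields-20544`).  The block is
pp. 380–392 = the displays (1.73)–(1.104) and every sentence between them.  At statement level this stretch is IN THE TREE
(cell SKELETON: 45 rows — 22 typed-existing, 11 proved-existing, 9 typed, 3 proved; 1 083 in-tree declarations in 92 files cite a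
locator in the range, CARVE-LIST §4) — so, by the fan's rule «IN TREE = CITE, NEVER RESTATE» (CARVE-RULES §2.3), this file
(a) RESTATES NOTHING: every printed statement of the block that has a declaration is cited BY NAME below (table + census);
(b) finds, after a sentence-by-sentence census of pp. 380–392 against the tree (below), NO printed statement of the block without an
in-tree home — the block's residual is EMPTY (CARVE-LIST §4 Block 40: «RESIDUAL candidates: none by display label»; the seven
constants∕dependency clauses and the eight claim cues it lists are each located below); (c) conjoins the block's printed
THEOREM-LEVEL statements, BY NAME and over the consumer's currency `C : B16.Construction`, into ONE hypothesis bundle `Hyp` a node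
prover takes as `(h : Hyp C …)`, with the kernel-checked projections and compositions a consumer wants — in particular ONE
coupling window serving the whole block (`Hyp.atCommonWindow`) and the block's last sentence, p. 391 ll. 1–2 *«This completes the
proof of Theorem 1 and Corollary 3»*, located as `Hyp.endStatementBPrinted_of_base` (the KEY's B16 conjunct MODULO the base of
the induction, [III] Thm 1 p. 262 — block 34 — which is not this block's).

## The block's SKELETON rows → the in-tree declarations this file CITES (never restates)

(module prefix `…Balaban1983to89.` dropped; «H» = hypothesis-form `Prop`, «T» = theorem, «D» = definition∕structure)

| row | print | in tree | used here |
|---|---|---|---|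
| B16.Eq1.73–1.75 | (1.73)–(1.75) p. 380 | T `B16.ineq173`, `B16.ineq174`, `B16.ineq175`, `B16.exp_neg_le_cos`, `B16.exp_neg_two_norm_le_re_cexp` (the complex-exponential inequalities, the bound `s` on σ a hypothesis — p. 379 derives it for the quadratic-form half, `B16Sect1Statements.SigmaQuad379`∕`SigmaV379`; the V(X~) half is cell GAPS G-adv3-21); D `B16Cor3Ops.PosOp` with T `PosOp.abs_apply_le` (the positive operation 𝐓′_k(X,(U,0)) and (1.73)); `B16Ineq175Tilted.*` (measure-level (1.73)–(1.75): `norm_integral_tiltWeight_smul_le`, `mul_exp_le_re_integral_tiltWeight`, `integral_tiltWeight_ne_zero` = p. 380 *«hence 𝐓′_k(X,(𝐔,𝐉))1 ≠ 0»*); `B14Cor3.LeafL1` | cited (theorems are not hypotheses) |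
| B16.Lem@380 | p. 380 l. 12 – p. 381 l. 3: the volume constant and the three large-field factors, the fundamental factor per component | D `B16LargeFieldFactors380.expP`∕`expQ`∕`expR`∕`minConst`; T `vacuumLine380`, `componentFactor_le`, `display381`, `fundamentalFactor_le`; H `B16StepFactorsPrinted.StepDisplaysAt` conjuncts (V), (F), (I) and H `B16StepFactorsPrinted.StepFactorsPrinted` (the per-step sentences as ONE printed claim over `B16.Construction`) | field `Hyp.stepFactors` |
| B16.Eq1.76 | (1.76) p. 381 | H `B16Sect1Kernels.Incl176`; T `B16Incl176Layers.largeField_next_eq`, `incl176_six`, `incl176_six_components` — and the located DEFECT of the printed `~2`: T `printed_two_layers_fail`, `six_layers_sharp` (the inclusion holds with `~6`, not `~2`; the cell's reading) | cited |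
| B16.Lem@381 | pp. 381–382, the preparatory factors (1 − χ_j^{(n)}, 1 − χ′_m, the second function of (1.28) [IV], 1 − χ_{j,Λ}) and case 1 of 1 − χ′ | T `B16Sect1Statements.prep381_chi_n`, `prep381_chi'` (*«The second function in the decomposition (1.28) [IV] yields the same final factor»* in its docstring), `prep381_chiΛ`; H `B16Sect1Statements.Ineq382V₁`, `Ineq382V'`; T `prep382_eps_choice`, `prep382_case1_factor`; D `B16Ineq382.Case1Hyp`, `B16Ineq382.FluctHyp` with T `B16Ineq382.ineq382V₁_gaugeFixed`, `FluctHyp.ineq382V₁`, `FluctHyp.ineq382V'` (the chain |V₁(b) − 1|, |V₀(b) − 1|, |v(x) − 1|, |V′(b) − 1| on the lattice carrier); `B16Ineq382WilsonFactor.*` (*«Then the Wilson action yields the factor …»*); `B16PrepFactorsLargest383.chi_n_le_largest`, `chi'm_le_largest`, `case1_le_largest` | cited; their OUTPUT is conjunct (P) of `StepDisplaysAt` (field `Hyp.stepFactors`) |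
| B16.Txt@382 | p. 382, case 2: *«The first order term can be estimated by …»* | H `B16Ineq177Assembly.FirstOrder382`; T `FirstOrder382.abs_lt`, `firstOrder382_of_letters`; `B16Lem381Case2.*` (*«We obtain (1.83)–(1.87) [IV] with k replaced by j, and with an additional factor R_j»*) | cited |
| B16.Eq1.77 | (1.77) p. 383 | H `B16Sect1Kernels.Ineq177`; T `B16Ineq177Assembly.ineq177_of_inputs`, `ineq177_of_firstOrder_bound`; p. 383 l. 6–7 *«We assume that g_j is sufficiently small, so that the constant on the right-hand side above is small, or O(1)»*: T `B16Ineq177Assembly.ineq177_lower_of_inputs_small` | cited |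
| B16.Eq1.78 | (1.78) p. 383 | H `B16Sect1Kernels.Ineq178`, `lfFactor178`; T `B16Sect1Kernels.form_lower_of_large_bond`, `lfFactor178_of_large`, `large_of_window`; T `B16Ineq178Nested.ineq178_T0`, `largeFieldFactor_T0`, `largeFieldFactor_T0_le_exp_neg_p0` (on the tree-gauged chain carrier); `B16Lem381Case2.case2Integral_lt_printed`, `B16PrepFactorsLargest383.case2_le_largest` | cited |
| B16.Txt@383 | p. 383 after (1.78): *«This is the largest factor … We assume that 2p₁ − (d + 5)r₀ > p₀, and we estimate the factors by exp(−p₀(g_j))»* | H `B16Sect1Kernels.ExponentProviso383`; T `B16Sect1Kernels.exp_lfFactor_le_exp_neg_p0`, `B16StepFactorsRounding.hround_of_largeness`, `stepFactor179_le_of_largeness`; `B16PrepFactorsLargest383.cmp_of_exponents` | cited |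
| B16.Txt@383b | p. 383 l. 19–26 (the group-valued integrals, the A_j-integrals, the sums over admissible sequences) | H `B16Ineq179.Txt383` | inside field `Hyp.displays` (`B16Sect1DisplaysPrinted.DisplaysAt`, third conjunct) and conjunct (I) of `StepDisplaysAt` |
| B16.Eq1.79 | (1.79) p. 383 | H `B16Ineq179.Ineq179`, `Ineq179Sup` (T `ineq179_iff_sup`), D `rhs179`; T `B16Ineq179.ineq179_of_factors` ((1.79) ⇐ per-step factors) with its per-step input T `B16StepFactorsPrinted.stepFactor179_le`; p. 383 last sentence – p. 384 l. 1 *«the above inequality holds for all large field regions, not only for the regions satisfying the conditions (i), (ii)»*: H `B16Sect1DisplaysPrinted.Coverage` (first half) | inside field `Hyp.displays`; `Hyp.ineq179` |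
| B16.Def@384 | p. 384: κ_j(Z), j(Z), the operation S (S(Z) = Z′^{~10}), Z^{(n−j)}, K | D `Step.Budget.ScaleData` (j(Z), κ_j(Z), the size profile, K), `Step.Budget.Consts`∕`Consts.cost`; D `B14DomainGeom.enl` with T `B16Incl176Layers.S_eq_enl_ten`, `S_iUnion`; D `B16SProfile.Sop`, `Siter`, `Qprod`; D `B16StoppingRule.StopAt` | carriers of field `Hyp.displays` |
| B16.Lem@384 ∕ B16.Eq1.80 | the INDUCTIVE STATEMENT with (1.80) p. 384 | H `Step.Budget.Controls` ((1.80) verbatim, cost `O(1)M^dR_n^{d+1}d′_n(S^{n−j}(Z))`), H `Step.Budget.ScaleData.Invariant`; T `Step.Budget.controls_zero_iff` | inside field `Hyp.displays` (fourth conjunct of `DisplaysAt`) |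
| B16.Eq1.81 | p. 384 l. 20 – p. 385 l. 8 and (1.81) | T `Step.Budget.L_iter_lt_63` (*«L_{n−j} ≦ 42(1 − L^{−(n−j)})∕(1 − L⁻¹) < 63»*), `Step.Budget.sqrt_scaling_le_half_pow` (*«From the scaling property (6.31) [I] … ≦ 2^{−(n−j)}d′_j(Z) for n − j > 1»*), `Step.Budget.majorant_181`; `B16SProfile.card_box`, `Sop_box_subset`, `Sop_one_box_subset` (*«for some steps we do not gain the scaling factor L⁻¹»*), `B15Claim177.budget_lt_63`; p. 385 *«K ≦ n₀ − j + R_j»*: H `B16Cor3Scales.Smallness`, T `smallness_of_horizon`, `B16StoppingRule.find_stopAt_le`; T `B16Lem384Induction.exists_birth_ofIndex`, `B16CubeCurrency.card_majorant_181_of_flow` | cited |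
| B16.Txt@385 ∕ B16.Eq1.82 | p. 385, the base j = 1: the gluing chain, (1.82) and its condition | T `B16Enlargement385.gluing_fam_collar_two`, `gluing_model`, `treeLen_collar_three_le_printed`, `newParts_binders_printed`; T `B16Ineq182Gluing.ineq182_of_def`; T `Step.Budget.base_182` (hypothesis `hcond` = *«¼γ₀(14)^{−d}A₁²p₀²(g₁) ≧ O(1)2(64)^dM^dL^{d+1}R₁^{d+2} … satisfied for p₀ large, and g₁ sufficiently small»*) | cited |
| B16.Eq1.83 | (1.83) p. 385 and p. 386 l. 1–3 (Z = S(Z₀); the renewed budget κ_{j+1}(Z) = p₀(g_j) − …, *«K = R_{j+1} for Z»*) | T `Step.Budget.case1_183`, `Step.Budget.reset_p386`; T `B16Incl176Layers.largeField_next_eq_S_of_no_new`; `B16Lem384Induction.OldPiece.controls`, `controls_iterate_cont` | cited |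
| B16.Eq1.84–1.88 | (1.84)–(1.88) pp. 386–387: the merge case (graph G, maximal tree, endpoint X, rest Y) | T `Step.Budget.gconn_leaf`, `merge_eq_186`, `merge_step`, `merge_controls`; T `B16Incl176Layers.incl184`, `incl184_six_of_construction`; D∕T `B16Lem384Induction.Case.κ` ((1.85)), `MergeIndex`, `MergeIndex.hc` ((1.86)), `MergeIndex.controls` ((1.87)); `B16MergeGeometry.merge_controls_conn` (*«d′_{j+1}(X) + d′_{j+1}(Y) + 2d ≧ d′_{j+1}(Z)»*), `B16MergeHorizon.condI_merge` (*«n₁ < 10 … K ≦ K₂ + n₁ + R_{j+1}»*), `B16Overhang.sum_overhang_amortised`, `B16OverhangN.sum_overhangN_amortised` — and the located DEFECT of p. 387 ll. 3–6: T `B16Absorption.no_uniform_absorption`, `one_layer_absorption` (the sub-additivity *«d′_n(S^{n−j−1}(Z)) ≦ d′_n(S^{n−j−1}(X)) + d′_n(S^{n−j−1}(Y))»* in its amortised reading); p. 387 *«for p₀ large and γ small enough»*: T `B16Improved189FullBudgetClauses.terminalConst_le_cost_one`, `hbudgetT_of_small_kappa` | cited |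
| B16.Eq1.89 | (1.89) p. 387 — THE FUNDAMENTAL INEQUALITY | H `Step.FundIneq189`; T `Step.Budget.fundIneq189_of_budget` (*«the domain X in the definition (1.71) satisfies the assumption of the statement with K = 0, therefore κ_k(X) ≧ 0»*); H `B16Cor3.FundIneq189Improved` with T `fundIneq189_of_improved` (*«an improved bound (1.89), with the additional term −κ₁d_k(X)»*), H `B16Sect1DisplaysPrinted.Coverage` (second half) | inside field `Hyp.displays`; `Hyp.fund189`, `Hyp.coverage189` |
| B16.Cor3@387 ∕ B16.Cor3 | p. 387 ll. 26–27 *«This implies the inequality (2.50) [III], hence Corollary 3»*; p. 391 ll. 1–2 | T `B16Cor3.uvIneq_of_structure` (the sentence as finite combinatorics over (1.72)∕(2.18), leaves U1, L1, L2 displayed), `B16Cor3Scales.uvIneq_of_structure_horizon`; H `B16.Cor3_250` ([III] Cor. 3 (2.50) verbatim), H `B16.Cor3Leaf`, H `B16.EndStatementBPrinted` with T `B16.endStatementBPrinted_of_leaves` | field `Hyp.cor3`; `Hyp.cor3_of_base`, `Hyp.endStatementBPrinted_of_base` |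
| B16.Lem@387M ∕ B16.Eq1.90–1.91 | pp. 387–388, the Mayer expansion and the polymer expansion (1.90)–(1.91) | T `B16Sect1Kernels.exp_sum_eq_mayer`, `exp_sum_eq_one_add`; T `B16Eq190Resummation.eq190`; D `B16Eq191PrintedActivity.mayerTerm191`; `B16CurlyBracketVolume.outside_nonempty_of_mem_polys190` | cited |
| B16.Eq1.92–1.96 | (1.92)–(1.96) pp. 388–389 with the five smallness clauses (α^{1∕3} ≦ exp(−(1+β)κ2d); O(1)α^{1∕3} ≦ 1 ≦ (6·2^d)⁻¹βκ; −2(1+β₀)⁻¹p₀(g_k) + 1 + 2κ(100R_k)^d ≦ −(3∕2)p₀(g_k) *«(for example, take β₀ = 1∕7 …)»*; exp(−½p₀(g_k))100^dR_k^{−d} < exp(−½p₀(g_k)) ≦ (6·2^d)⁻¹βκ) | H `B16Ineq197.Polymer.Major192`, `Subadd193`, `Anch194`, `Count196`; T `B16Ineq197.Polymer.norm_term_le` ((1.95)), T `B16Ineq197.ineq197_of_leaves` ((1.92)–(1.96) + clauses ⇒ (1.97)); T `B16.budget_beta0_iff`, `budget_beta0_le` | cited |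
| B16.Eq1.97 | (1.97) pp. 389–390 with its c₁-clause | H `B16.Ineq197` (over `B16.RelDomainSys`, (1.67)) | inside field `Hyp.displays` |
| B16.Eq1.98–1.99 | (1.98)–(1.99) p. 390 | H `B16.Ineq199`; T `B16Exp198.Geometry.ineq199_of_ineq197` ((1.97) ⇒ (1.98)–(1.99), Kotecký–Preiss with the «proper notational changes»); `B16CurlyBracketVolume.re_Z_pos`, `exists_real_log_Z`, `norm_sum_term_le_exp`; p. 390 l. 9 *«admissible domains … have the intersections sufficiently large»*: T `B16.ineq1100_of_199_adm` | inside field `Hyp.displays` |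
| B16.Eq1.100 | (1.100) p. 390 | H `B16.Ineq1100`; T `B16.ineq1100_of_199`, `ineq1100_of_199_floor`, `ineq1100_of_199_adm`, `boundR231_of_ineq1100`, `lfBoundR_new_of_ineq1100` ((1.100) ⇒ (2.31) [III]); T `B16.relDecay_not_fullDecay`; p. 390 *«they are Euclidean covariant, i.e., they have the property (2.32) [III]»*: H `Step.LFNewCov` (field `cov232`), T `B16PointGroupAverage.avg_equivariant_sup` | inside field `Hyp.displays`; `Hyp.ineq1100` |
| B16.Eq1.101 | (1.101) p. 390 | H `B16Cor3.Repr1101`; T `B16Cor3.repr1101_of_198` ((1.98) regrouped), `B16Cor3.norm_newR_le` | cited (a regrouping identity given (1.98); not a bundle slot) |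
| B16.Ind | p. 390 *«This new action satisfies the induction hypothesis …»*, p. 390 last ¶ – p. 391 l. 2 *«the result 𝐑ρ_k … can be written in the form (2.18) [III], with all the expressions satisfying the induction hypothesis … This completes the proof of Theorem 1 and Corollary 3»*; base [III] Thm 1 p. 262 | H `B16.InductionStep`, H `B16.InductionBase`; T `B16.thm1_of_steps`, `B16.inductionStep_of_thm1With`; clause level: H `Step.LFNewTerms`, `Step.LFNewTermsB`, `Step.LFNewCov` (the new-term obligations of the step k → k+1) | field `Hyp.newAction`; `Hyp.thm1_of_base` |
| B16.Eq1.102 | (1.102) p. 390 (*«The new large field region is equal to Z_k ∪ ⋃_{i=1}^m Y_i, and the operation 𝐓_k for a component Y … has the form»*) | H `B16Cor3.Form1102` (reading note: the factor χ_i dropped in print, cell GAPS C-adv7-91); T `B16Cor3Ops.mulOp_comp_one_le`, `tys_one_le_of_factors`, D `B16Cor3Ops.tagEmb` | cited (a definition of the renormalised operation; not a claim) |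
| B16.Eq1.103 | (1.103) p. 391, the final remark | T `B16Cor3.identity1103` (valid iff every 𝐓′_k(Y_i)1 ≠ 0, (1.74)) | cited |
| B16.Eq1.104 | (1.104) pp. 391–392 with the second exponentiation (*«the 𝐓′_k-operations are normalized … such factors are not needed, because there are no summations over these domains, they are fixed»*) | D `B16Cor3.Repr1104`, H `Repr1104.Holds`, T `Repr1104.allSmall_term`, `Repr1104.termData_holds`; H `B16Cor3.SecondExpLeaf` — the NAMED UNPRINTED-JUSTIFICATION LEAF of cell GAPS G-B16-11 (objection G-adv3-4 upheld: the printed justification does not give the absolute convergence; (1.104) is NOT load-bearing for Theorem 1 ∕ Corollary 3, whose proof closes p. 391 ll. 1–2) | cited ONLY — deliberately NOT a bundle slot (a consumer of (1.104) must name `SecondExpLeaf` itself) |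

## Census of the REMAINING printed statements of pp. 380–392 (every sentence that asserts something, page by page)

* p. 380 l. 1 (*«exponential density in the integral is positive. This implies the inequalities (1.73)»*) and l. 6–8 (*«𝐓′_k(X,(U,0))1 is
  obviously positive, although it may be very small, hence 𝐓′_k(X,(𝐔,𝐉))1 ≠ 0»*): `B16Cor3Ops.PosOp` (positivity as structure data),
  `B16Ineq175Tilted.integral_tiltWeight_ne_zero`; the positivity itself is the unprinted domain lemma of cell GAPS G-adv3-2a ∕ G-B16-12 — cited.
* p. 380 l. 8–9 (*«we have to find a bound of 𝐓′_k(X,(U,0))1, which we denote for simplicity by 𝐓′_k(X)1»*) — notation; the object is the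
  carrier `T1` of `B16Sect1DisplaysPrinted.StepCarriers` ∕ `B16StepFactorsPrinted.StepCarriers`.
* p. 380 l. 10–18 (*«V(X~) is bounded in (1.69). Similar bounds hold for vacuum energy counterterms and normalization constants, except that
  for the last we have the corresponding constant O(log g_j⁻²) instead of O(1). In effect we get a bound, to which every large field domain Z_j
  contributes the constant O(1) log g_j⁻²|Z_j| ≦ O(1) log g_j⁻²(MR_j)^d d′_j(Z_j) ≦ O(1)M^dR_j^{d+1}d′_j(Z_j)»*): `B16.Ineq169` ((1.69), block 39),
  conjunct (V) of `B16StepFactorsPrinted.StepDisplaysAt` (first form) and `B16LargeFieldFactors380.vacuumLine380` (the chain): cited.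
* p. 380 l. 19–21 (*«Here the situation is almost exactly the same as in [16], so we summarize the results»*) — by-reference claim to
  [Balaban1985UV3] (71): carried by `StepDisplaysAt`'s docstring («Theorem 1 [15] + (71) [16] + the positivity bound (1.7)», rows B11.Thm1,
  B10.Eq71, B16.Eq1.7 of the cell): cited.  *«(in this factor we may take γ₀ = 1∕2)»*: letter `γ₀` of `B16StepFactorsPrinted.Consts` ∕
  `B16LargeFieldFactors380` (docstrings quote it): cited.
* p. 381 l. 3–4 (*«These are the fundamental large field factors, which control convergence of the expansion of the effective densities»*)
  — narrative.  p. 381, every «yields the factor» sentence — row B16.Lem@381: cited.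
* p. 381 l. 20 – p. 382 l. 13 (case 1 of 1 − χ′: the axial gauge, v(x) = V₀(Γ_{y,x}), V₁ = V″^v; *«By elementary reasoning, the same as in
  the proof of Lemma 1 [14], we obtain the estimate |V₁(b) − 1| < 6(100MR_{j−N+1})²ε ≦ 6(100M(L+1)N^{β₀}R_j)²ε»*; |V₀(b) − 1|; |v(x) − 1|;
  |V′(b) − 1|; *«By our assumptions on N the number multiplying δ′_j is small, e.g., it is smaller than 1∕4, hence |B′(b)| < 12R_j⁴ε +
  ½δ′_j. If we take ε = (24R_j⁴)⁻¹δ′_j, then |B′(b)| < δ′_j. This implies that at least one plaquette variable has to satisfy the opposite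
  inequality»*; the Wilson factor exp(−A₁²48⁻²R_j⁻⁸p₁²(g_j)) ≦ exp(−R_j⁻⁸p₁²(g_j))): `B16Sect1Statements.Ineq382V₁`∕`Ineq382V'`∕
  `prep382_eps_choice`∕`prep382_case1_factor`, `B16Ineq382.FluctHyp.*` (`norm_V₁_sub_one_le`, `norm_treeGaugeFn_sub_one_le`,
  `norm_fluct_sub_one_lt`, `ineq382V'`), `B16Ineq382TreeGauge.ineq382V₁_gaugeFixed`, `B16Ineq382WilsonFactor.exp_wilsonSum_le`,
  `B16Sect1Kernels.NWindow` (*«our assumptions on N»*, (1.30) p. 363): cited.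
* p. 382 l. 15 – p. 383 l. 5 (case 2: ζ₁, *«Although we get a worse bound this time … the bound is still a small constant»*, the gauge
  changes, *«We obtain (1.83)–(1.87) [IV] with k replaced by j, and with an additional factor R_j»*, the first-order display, *«Using the
  local version of the bound (1.7) we can bound this quadratic form from below by γ₀ Σ |(∂B)(p′)|²»*): `B16Ineq177Assembly.FirstOrder382`,
  `firstOrder382_of_letters`, `ineq177_of_firstOrder_bound`, `B16Lem381Case2.*`: cited.
* p. 383 l. 13–18 (the choice of the bond b with |B(b)| ≧ g_j⁻¹δ′_j = A₁p₁(g_j); the displayed factor and *«This is the largest factor …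
  we estimate the factors by exp(−p₀(g_j))»*) — rows B16.Eq1.78, B16.Txt@383: cited (note `B16PrepFactorsLargest383`'s reading of the
  printed left member's `p₁(g_j)` vs the right member's `p₁²(g_j)`).
* p. 383 l. 27–28 (*«Let us summarize now the results of the above estimates. We have obtained the following inequality: (1.79)»*), p. 383
  l. 30 – p. 384 l. 1 (the range of Π′, the supremum over admissible domains *«in particular the conditions (1.76)»*, *«holds for all large
  field regions»*) — row B16.Eq1.79: cited.
* p. 384 l. 1–3 (*«For the last regions we will prove that the expression on the right-hand side can be estimated by exp(−2p₀(g_k))»*) = (1.89);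
  l. 3–9 (the factorization per component, *«we write the factor connected with Z in the form exp(−κ_j(Z) − 2p₀(g_{j(Z)}))»*) — carriers
  `Step.Budget.ScaleData`; l. 9–19 (the operation S, *«Such a domain arises as a new large field region in our procedure, if no large fields are
  created in a neighborhood of Z, more precisely in S(Z)∖Z»*, *«the expression in the first exponential in (1.79) has a universal character»*)
  — definitions∕narrative; THE INDUCTIVE STATEMENT and (1.80) — row B16.Lem@384: cited.
* p. 384 l. 20 – p. 385 l. 8 (every geometric inequality of the estimate of the sum in (1.80): *«S^{n−j}(□) is a cube, which is a union of
  L^d_{n−j}MR_n-cubes»*, the 63 bound, *«The MR_n-cube in the center of S^{n−j}(□) contains □»*, S^{n−j}(Z) ⊂ ⋃ □₀^{~31}, the (63)^d∕(64)^d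
  bounds, the (6.31) [I] scaling, *«The square root appears here, because for some steps we do not gain the scaling factor L⁻¹ (then R_{m+1} =
  LR_m)»*, n₀, *«S^{n₀+1−j}(Z) is contained in a cube of the size 64MR_{n₀+1}, hence it satisfies the condition (i), and doing at most R_j
  further steps we obtain a domain satisfying both conditions (i), (ii). Thus K ≦ n₀ − j + R_j»*, (1.81)) — row B16.Eq1.81: cited
  (`Step.Budget.majorant_181` carries the undisplayed input R_n ≦ LR_j as its binder `hR`).
* p. 385 l. 9–22 (the base j = 1) and l. 23 (*«This condition is satisfied for p₀ large, and g₁ sufficiently small»*) — row B16.Txt@385 ∕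
  B16.Eq1.82: cited (`Step.Budget.base_182`'s `hcond`).
* p. 385 l. 23 – p. 386 l. 3 (first case, incl. the renewal *«Then κ_j(Z₀) ≧ 0, and we do not have a better bound for it, but we have the new
  factor exp(−p₀(g_j)). We define κ_{j+1}(Z) = p₀(g_j) − O(1)M^dR_{j+1}^{d+1}d′_{j+1}(Z). It satisfies (1.80), because Z is a small domain, it
  is contained in a cube of the size 100MR_{j+1}, hence K = R_{j+1} for Z»*) — row B16.Eq1.83: cited (`Step.Budget.reset_p386`).
* p. 386 l. 3 – p. 387 l. 21 (second case: (1.84), (1.85), the induction over the number of domains, the graph G *«By (1.84) the graph G is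
  connected»*, maximal tree, endpoint X ∕ rest Y, *«The statement (1.80) holds also for X and κ_{j+1}(X), because there is the exactly one
  domain in X»*, Z ⊂ X ∪ Y, (1.86), *«The index j(Z) is equal to one of the indices j(X), j(Y), hence 2p₀(g_{j(X)}) + 2p₀(g_{j(Y)}) −
  2p₀(g_{j(Z)}) ≧ 2(1+β₀)⁻¹p₀(g_{j+1})»*, *«d′_{j+1}(X) + d′_{j+1}(Y) + 2d ≧ d′_{j+1}(Z)»*, (1.87), the 20MR_n-cube sentence, K₁ ≦ K₂, n₁ < 10,
  *«S^{n−j−1}(Z) = S^{n−j−1}(Y) for n ≧ j + 1 + K₁ + n₁, and that K ≦ K₂ + n₁ + R_{j+1}»*, (1.88), *«for p₀ large and γ small enough. This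
  completes the inductive proof of the statement»*) — row B16.Eq1.84–1.88: cited; the maximal-tree endpoint is DISCHARGED in `Step` Part F4
  (`Step.Budget.gconn_leaf`, Mathlib spanning trees) and `B16Improved189FullBudgetMergeWitness.gconn_pair`∕`exists_mergeIndex_witness`; the
  p₀-increment inequality is the binder `hP`∕`q` of `Step.Budget.merge_step` ([III] §2 monotonicity of p₀(g_j) along the flow).
* p. 387 l. 22–27 (*«Let us draw some conclusions … κ_k(X) ≧ 0, and we have the fundamental inequality (1.89). Next, we have noticed already
  that the inequality (1.79) holds for the 𝐓-operation connected with an arbitrary large field region. The inequality (1.80) holds quite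
  generally for such regions, hence also an improved bound (1.89), with the additional term −κ₁d_k(X) in the exponential. This implies the
  inequality (2.50) [III], hence Corollary 3.»*) — rows B16.Eq1.89, B16.Cor3@387: cited; in the bundle as the (1.89)- and `Coverage`-conjuncts
  of `Hyp.displays` and as `Hyp.cor3`.
* p. 387 l. 28 – p. 388 l. 12 (the Mayer expansion *«the same as in (7.1) [I]»* = (2.1) of [II] (cell DIVERGENCE D-T1b), the localization
  domain X′₀, the new connectedness *«we consider two such components as connected, if they are contained in one localization domain Y of a
  term in the product. This means that each component has a correct tree graph decay factor»*, (1.90), (1.91), the summation constraint) —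
  rows B16.Lem@387M, B16.Eq1.90–1.91: cited (`B16Eq190Resummation`: 144 declarations; `B16Eq191PrintedActivity`).
* p. 388 l. 13 – p. 390 l. 2 ((1.92) with *«we have estimated the expression |σ| in (1.73) by 1»*, (1.93) with *«α is sufficiently small,
  e.g., α^{1∕3} ≦ exp(−(1+β)κ2d)»*, the «usual way» display, (1.94) with the c₀-clause *«c₀ = 1, if the empty subfamily is admissible in the
  sum over 𝐃, and c₀ = α^{1∕3} in the remaining cases. The first case is possible, if X′ is one of the domains X_j^~, and then we have the
  small factor from the bound (1.89)»*, *«|X′∖Z′| ≦ |X′∖∪Y_i|, and we use the fact that O(1)α^{1∕3} ≦ 1 ≦ 1∕(6·2^d)βκ for κ large enough,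
  hence the above bound is cancelled»*, *«The product over h there is estimated by Π exp 2κ(100R_k)^d»*, the g_k-smallness *«−2(1+β₀)⁻¹p₀(g_k)
  + 1 + 2κ(100R_k)^d ≦ −(3∕2)p₀(g_k) (for example, take β₀ = 1∕7 …)»*, (1.95), the two cases for c₀, (1.96), *«exp(−½p₀(g_k))100^dR_k^{−d} <
  exp(−½p₀(g_k)) ≦ (1∕(6·2^d))βκ for g_k small, hence the above bound is cancelled by the last exponential in (1.95)»*, (1.97) and its
  c₁-clause p. 390 l. 1–2) — rows B16.Eq1.92–1.96, B16.Eq1.97: cited (`B16Ineq197.ineq197_of_leaves` consumes exactly these five clauses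
  as displayed hypotheses; `B16.budget_beta0_iff` CONFIRMS the β₀ = 1∕7 parenthesis).
* p. 390 l. 3–22 ((1.98); *«The summation here is over domains X ∈ 𝐃_k, which have nonempty intersections with Z^c_k. In fact, admissible
  domains … have the intersections sufficiently large, because they contain at least one large field region connected with one of the
  𝐓′_k-operations»*; *«𝐑′^{(k)}(X) depends on the background field U_k restricted to X, and it can be extended as an analytic function of
  the variables (𝐔,𝐉), defined on the space Ũ^c_k(X, α̃₀, α̃₁). It is given by the convergent series (7.13) [I]»* = (2.13) of [II]; (1.99);
  the two groups and 𝐁′^{(k)}(X); (1.100); the (2.32) [III] covariance) — rows B16.Eq1.98–1.99, B16.Eq1.100, B16.Eq1.101: cited (the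
  restriction∕analyticity sentence is the carrier `dom : S.Dom → Set Φ` of `B16.Ineq199` and the hypothesis of
  `B16Exp198.Geometry.ineq199_of_ineq197`; at clause level it is `Step.LFNewTerms`∕`B14Eq227LocalizedTerms.LFHypAnalytic` of the step).
* p. 390 l. 23 – p. 391 l. 2 ((1.101); *«This new action satisfies the induction hypothesis, as it follows from the construction and the
  properties of the new terms»*; the new large field region Z_k ∪ ⋃Y_i and (1.102); *«From (1.72), (1.98), and the above definitions, it
  follows that the result 𝐑ρ_k of the 𝐑-operation can be written in the form (2.18) [III], with all the expressions satisfying the induction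
  hypothesis described in Sect. 2 [III]. This completes the proof of Theorem 1 and Corollary 3.»*) — rows B16.Eq1.101, B16.Ind, B16.Eq1.102,
  B16.Cor3: cited; in the bundle as `Hyp.newAction` (`B16.InductionStep`) and `Hyp.cor3`; the cell's clause-by-clause audit of the sentence
  (what §1 delivers: (1.99), (1.100), (1.102); what it asserts: (2.32), «all the properties») is GAPS G-r2.8 ∕ G-B16-10 and travels with
  `B16.InductionStep`'s docstring.
* p. 391 l. 3 – p. 392 l. 12 (the final remark: (1.103), *«We apply successively the same steps … we describe now changes and differences
  only»*, *«using the fact that the 𝐓′_k-operations are normalized, i.e., if such an operation is applied to a function which does not depend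
  on the integration variables connected with the operation, then it is equal to 1»*, the list of changes (no first two sums; e³ over i with
  Y_i ⊂ X′; β ↦ ¼β; α ↦ O(1)c₁; (1.93) with d_k(X′∖∪Y_i) and no product over h; (1.94); (1.95) without the first two sums and the first
  exponential), *«This bound is enough for the convergence … looking carefully at a standard proof of the convergence of the expansion (e.g.,
  in [26]), we see that in the present situation such factors are not needed, because there are no summations over these domains, they are
  fixed»*, (1.104), p. 392 *«hence 𝐓_k(Y_i) is the multiplication operation. These functions depend only on the new field variables V_k
  restricted to Y_i … The representation (1.104) can be used alternatively in the inductive description of the effective actions, and the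
  above considerations leading to it give the proof of Theorem 1»*) — rows B16.Eq1.103, B16.Eq1.104: cited ONLY (`B16Cor3.identity1103`,
  `Repr1104`, `SecondExpLeaf` — cell GAPS G-B16-11: the second exponentiation is NOT established in print; nothing here relies on it).
* p. 392: acknowledgements and references [I]–[IV] — no statement.

RESULT OF THE CENSUS: NO printed statement of pp. 380–392 lacks an in-tree declaration; the block's residual is EMPTY and this file
types NO new `…Printed` statement.  Two printed displays of the block stand CORRECTED in the tree, by theorems, and are cited in their
corrected reading, never restated: (1.76)'s `~2` (`B16Incl176Layers.printed_two_layers_fail` ∕ `six_layers_sharp`) and p. 387 ll. 3–6's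
uniform sub-additivity (`B16Absorption.no_uniform_absorption` ∕ `one_layer_absorption`).

## What is here
* §1 `Hyp C Xs cs Xd Y cd κ₁` — ONE `Prop`-valued structure over the consumer's currency `C : B16.Construction` (the K1⁷ record's
  `.C`), conjoining BY NAME: `stepFactors` = `B16StepFactorsPrinted.StepFactorsPrinted C Xs cs` (pp. 380–383, the per-step factor sentences
  before (1.79), on the one-step carriers `Xs P j` and letters `cs`); `displays` = `B16Sect1DisplaysPrinted.Sect1DisplaysPrinted C Xd Y cd κ₁`
  ((1.72) [block 39], (1.79), p. 383 l. 19–26, (1.80), (1.89), the coverage sentence p. 387 l. 23–27, (1.97), (1.99), (1.100), on the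
  display carriers `Xd P k`, the second operation family `Y P k`, letters `cd`, `κ₁`); `newAction` = p. 390–391's sentence in the shape
  `∃ γ > 0, B16.InductionStep C γ` (Theorem 1's window quantifier, as in `B16.Thm1Printed`); `cor3` = `B16.Cor3Leaf C` (p. 387 l. 26–27 ∕
  p. 391 l. 2: [III] Cor. 3 under Theorem 1).
* §2 kernel-checked bookkeeping out of `Hyp` (no statement asserted): the projections `Hyp.stepDisplays`, `Hyp.ineq179`, `Hyp.fund189`,
  `Hyp.coverage189`, `Hyp.ineq1100` (by the siblings' `And`-eliminations); ★ `Hyp.atCommonWindow` — p. 355's *«sufficiently small positive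
  γ»* ONCE for the whole block: one γ > 0 such that on every run in the window ]0, γ] the per-step sentences hold at every step j < K, the
  displays and the coverage sentence at every k ≦ K, and the induction step k → k+1 at every k < K (`min` over the three windows,
  `B14Cor3.inInterval_of_le`); `Hyp.thm1_of_base` — p. 391 l. 1–2 located: with the base of the induction ([III] Thm 1 p. 262, `B16.InductionBase`,
  block 34's row, supplied by the consumer at any window γ_b > 0) the bundle yields `B16.Thm1Printed C` (`B16.thm1_of_steps` at `min γ γ_b`);
  `Hyp.cor3_of_base` (then `B16.Cor3_250 C`) and ★ `Hyp.endStatementBPrinted_of_base` (then `B16.EndStatementBPrinted C` — the B16 conjunct of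
  the KEY item's conclusion, `B16.endStatementBPrinted_of_leaves`); and the converse bookkeeping `newAction_cor3_of_endStatementBPrinted` —
  the two theorem-level fields are IMPLIED by the end statement (`B16.inductionStep_of_thm1With`), so the bundle's last two slots are Theorem 1's
  printed proof SHAPE and [III] Cor. 3's leaf, not stronger claims.

## HONEST SCOPE — what is NOT claimed
Nothing of [B16] is proved here and no `…Printed` statement is asserted: `Hyp` is a HYPOTHESIS bundle; the theorems are bookkeeping
between typed shapes (projections, a `min` of windows, one induction on k ≦ K through `B16.thm1_of_steps`).  With carriers chosen freely
the two display bundles are VACUOUS IN ISOLATION (their own docstrings: inhabited by trivial data); the bundle earns its keep only at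
Bałaban's own objects of (1.71)∕(1.72) — the cell's (A1c)∕J3 junction, not typed here.  The cell's GAPS rows travel with the cited names
(G-adv3-21 the V(X~)-half of the σ-bound behind (1.73); G-adv3-2a ∕ G-B16-12 the positivity of 𝐓′_k(X,(U,0))1; G-B16-05∕-10 relative vs full
decay in (1.68)∕(1.99) against (2.42) [III]; G-r2.8 ∕ G-B16-10 the clause audit of «satisfies the induction hypothesis»; G-B16-11 the second
exponentiation (1.103)→(1.104); G-adv3-1∕-2 the leaves U1, L1, L2 of «This implies (2.50) [III]»; G-pv06-1 the k-uniformity of E_±; D-b02.7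
the floor behind (1.100); the ~6-for-~2 reading of (1.76); the amortised reading of p. 387's sub-additivity).  No summit statement is
proved by this seat; K1⁷ ∕ node n13 is NOT discharged; the file moves no node count; one lattice paper at finite K — nothing continuum ∕
ℝ⁴ ∕ OS ∕ mass-gap ∕ Clay.  No `sorry`, no `instance`, no `notation`, no attribute manipulation; imports `…B16StepFactorsPrinted` (hence
`…B16Sect1DisplaysPrinted`, `…B16Ineq179`, `…B16Cor3Ops`, `…B16`) and `…B16Cor3` (hence `…B14Cor3`) only.
-/

namespace Literature.MathematicalPhysics.QuantumFieldTheory.Balaban1983to89.B16Carve40BoundsCor3Hyp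

/-! ## §1 The block-40 hypothesis bundle -/

/-- **BLOCK 40 OF [B16] AS ONE HYPOTHESIS BUNDLE** (pp. 380–392 [PDF 26–38]): the printed theorem-level statements of the block that
the tree carries in hypothesis form over a construction `C : B16.Construction`, conjoined BY NAME —
`stepFactors` = **pp. 380–383, the per-step large-field factor sentences before (1.79)** (`B16StepFactorsPrinted.StepFactorsPrinted`;
p. 380 l. 8–18 *«From the inequality (1.73) it is clear that we have to find a bound of 𝐓′_k(X,(U,0))1, which we denote for simplicity by
𝐓′_k(X)1. At first we bound all the expressions in the exponential, except the Wilson action and the quadratic forms. … In effect we get a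
bound, to which every large field domain Z_j contributes the constant O(1) log g_j⁻²|Z_j| …»*, p. 380 bottom – p. 381 top *«For each
component the above large field factors yield an exponential factor, which can be estimated by exp(−γ₀ min{½B₃⁻²A₀², 2A₁², A₁²}p₀²(g_j)
(d′_j(Z_j^{(i)}) + 1)) ≦ exp(−½γ₀A₁²p₀²(g_j)(d′_j(Z_j^{(i)}) + 1) − 2p₀(g_j))»*, p. 383 after (1.78) *«This is the largest factor among all
the small factors we have obtained from the large field characteristic functions in the preparatory steps»*, p. 383 l. 19–26);
`displays` = **(1.79) p. 383, p. 383 l. 19–26, the inductive statement (1.80) p. 384, the fundamental inequality (1.89) p. 387 with the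
coverage sentence p. 387 l. 23–27, (1.97) pp. 389–390, (1.99)–(1.100) p. 390** — together with (1.72) p. 379 of block 39 —
(`B16Sect1DisplaysPrinted.Sect1DisplaysPrinted`; p. 383 *«Let us summarize now the results of the above estimates. We have obtained the
following inequality: 𝐓′_k(X)1 ≦ sup exp{Σ_{j=1}^k O(1)M^dR_j^{d+1}d′_j(Z_j)} · Π_{j=1}^k Π_i exp(−½γ₀A₁²p₀²(g_j)(d′_j(Z_j^{(i)}) + 1) − 2p₀(g_j))
Π′ exp(−p₀(g_j)), (1.79)»*; p. 384 *«The factor exp(−κ_j(Z)) controls K renormalization steps, under the assumption that no large fields are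
created in these steps, where the number K is the smallest positive integer having the property that the domain S^K(Z), considered as a
domain in the lattice of the scale L^{−(j+K)}, satisfies the conditions (i), (ii), with N = R_j. More precisely this means that κ_j(Z) ≧
Σ_{n=j+1}^{j+K} O(1)M^dR_n^{d+1}d′_n(S^{n−j}(Z)). (1.80)»*; p. 387 *«therefore κ_k(X) ≧ 0, and we have the fundamental inequality 𝐓′_k(X)1 ≦
exp(−2(1 + β₀)⁻¹p₀(g_k)). (1.89)»*; p. 390 *«|F(X′)| ≦ c₁ exp(−(1 + β)κd_{k,∪Y_i}(X′)), (1.97) where c₁ = exp(−p₀(g_k)) if X′ does not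
intersect ⋃_{i=1}^m Y_i, and c₁ = α^{1∕3} in the remaining cases»*, *«|𝐑′^{(k)}(X,(𝐔,𝐉))| ≦ O(1)c₁ exp(−(1 + ½β)κd_{k,∪Y_i}(X)). (1.99)»*,
*«|𝐑′^{(k)}(X,(𝐔,𝐉))| ≦ exp(−p₀(g_k)) exp(−κd_k(X)). (1.100)»*);
`newAction` = **p. 390 l. 29–30 and p. 390 last ¶ – p. 391 l. 2** (`B16.InductionStep`, in Theorem 1's window quantifier ∃ γ > 0:
*«This new action satisfies the induction hypothesis, as it follows from the construction and the properties of the new terms. … From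
(1.72), (1.98), and the above definitions, it follows that the result 𝐑ρ_k of the 𝐑-operation can be written in the form (2.18) [III],
with all the expressions satisfying the induction hypothesis described in Sect. 2 [III]. This completes the proof of Theorem 1 and
Corollary 3.»*);
`cor3` = **p. 387 l. 26–27 ∕ p. 391 l. 2** (`B16.Cor3Leaf`: [III] Cor. 3 (2.50) under Theorem 1 — *«This implies the inequality (2.50)
[III], hence Corollary 3.»*).
The other displays of the block ((1.73)–(1.78), (1.81)–(1.88), (1.90)–(1.96), (1.98), (1.101)–(1.104)) are PROVED ∕ BODIED ∕ typed as
inputs of these in the sibling modules of the module docstring's table and take no slot.  Explicit carriers: the one-step factor carriers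
`Xs P j` with letters `cs` (`B16StepFactorsPrinted.StepCarriers`∕`Consts`), the display carriers `Xd P k`, the second operation family
`Y P k` with letters `cd` and the improved-(1.89) rate `κ₁` (`B16Sect1DisplaysPrinted.StepCarriers`∕`CoverCarriers`∕`Consts`).  Hypothesis
slot only; nothing asserted.
[cite: Balaban1989LargeFieldII, pp.380-383 (before (1.79)), (1.79) p.383, (1.80) p.384, (1.89) p.387, (1.97)-(1.100) pp.389-390, p.390-391 (end of the proof of Thm 1), Cor 3 p.387 and p.391] -/
structure Hyp (C : B16.Construction)
    (Xs : (P : B12.RunParams) → (j : ℕ) → B16StepFactorsPrinted.StepCarriers (C P) j) (cs : B16StepFactorsPrinted.Consts)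
    (Xd : (P : B12.RunParams) → (k : ℕ) → B16Sect1DisplaysPrinted.StepCarriers (C P) k)
    (Y : (P : B12.RunParams) → (k : ℕ) → B16Sect1DisplaysPrinted.CoverCarriers (C P) k)
    (cd : B16Sect1DisplaysPrinted.Consts) (κ₁ : ℝ) : Prop where
  /-- pp. 380–383, the per-step factor sentences before (1.79) — in tree: `B16StepFactorsPrinted.StepFactorsPrinted`. -/
  stepFactors : B16StepFactorsPrinted.StepFactorsPrinted C Xs cs
  /-- (1.72), (1.79), p. 383 l. 19–26, (1.80), (1.89), p. 387 l. 23–27, (1.97), (1.99), (1.100) — in tree: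
  `B16Sect1DisplaysPrinted.Sect1DisplaysPrinted`. -/
  displays : B16Sect1DisplaysPrinted.Sect1DisplaysPrinted C Xd Y cd κ₁
  /-- p. 390–391, «This new action satisfies the induction hypothesis … This completes the proof of Theorem 1» — in tree:
  `B16.InductionStep`, here under Theorem 1's window quantifier. -/
  newAction : ∃ γ : ℝ, 0 < γ ∧ B16.InductionStep C γ
  /-- p. 387 l. 26–27 ∕ p. 391 l. 2, «hence Corollary 3» — in tree: `B16.Cor3Leaf` ([III] Cor. 3 (2.50) under Theorem 1). -/
  cor3 : B16.Cor3Leaf C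

/-! ## §2 Bookkeeping (kernel-checked uses of the cited declarations; no statement asserted) -/

section Proj

variable {C : B16.Construction}
  {Xs : (P : B12.RunParams) → (j : ℕ) → B16StepFactorsPrinted.StepCarriers (C P) j} {cs : B16StepFactorsPrinted.Consts}
  {Xd : (P : B12.RunParams) → (k : ℕ) → B16Sect1DisplaysPrinted.StepCarriers (C P) k}
  {Y : (P : B12.RunParams) → (k : ℕ) → B16Sect1DisplaysPrinted.CoverCarriers (C P) k}
  {cd : B16Sect1DisplaysPrinted.Consts} {κ₁ : ℝ}

/-- **pp. 380–383 at every step of every run in the window**: the per-step factor sentences `StepDisplaysAt` (conjuncts (Y) «yields the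
factor», (V) the volume constant, (F) the fundamental factor per component, (P) the largest preparatory factor, (I) the integrals of
p. 383 l. 19–26), by unfolding the field `stepFactors`. [cite: Balaban1989LargeFieldII, pp.380-383 (before (1.79)) (bookkeeping)] -/
theorem Hyp.stepDisplays (h : Hyp C Xs cs Xd Y cd κ₁) :
    ∃ γ : ℝ, 0 < γ ∧ ∀ P : B12.RunParams, (C P).flow.InInterval γ P.K → ∀ j, j < P.K →
      B16StepFactorsPrinted.StepDisplaysAt (C P) j (Xs P j) cs :=
  h.stepFactors

/-- **(1.79) p. 383** on the display carriers of every step in the window, projected from the field `displays`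
(`B16Sect1DisplaysPrinted.ineq179_of`). [cite: Balaban1989LargeFieldII, (1.79) p.383 (bookkeeping)] -/
theorem Hyp.ineq179 (h : Hyp C Xs cs Xd Y cd κ₁) :
    ∃ γ : ℝ, 0 < γ ∧ ∀ P : B12.RunParams, (C P).flow.InInterval γ P.K → ∀ k, k ≤ P.K →
      B16Ineq179.Ineq179 (Xd P k).adm (Xd P k).T1 k (Xd P k).dZ (Xd P k).comps (Xd P k).primed (Xd P k).dC cd.C179 cd.M cd.γ₀
        cd.A₁ cd.d (fun j => cd.R ((C P).flow.g j)) (fun j => p0Profile cd.A₀ cd.p₀ ((C P).flow.g j)) :=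
  B16Sect1DisplaysPrinted.ineq179_of h.displays

/-- **(1.89) p. 387, the fundamental inequality, for every large-field region of every step in the window** — *«𝐓′_k(X)1 ≦
exp(−2(1 + β₀)⁻¹p₀(g_k))»* —, projected from the field `displays` (`B16Sect1DisplaysPrinted.fund189_of`).
[cite: Balaban1989LargeFieldII, (1.89) p.387 (bookkeeping)] -/
theorem Hyp.fund189 (h : Hyp C Xs cs Xd Y cd κ₁) :
    ∃ γ : ℝ, 0 < γ ∧ ∀ P : B12.RunParams, (C P).flow.InInterval γ P.K → ∀ k, k ≤ P.K →
      ∀ X : (Xd P k).Dom, Step.FundIneq189 ((Xd P k).T1 X) cd.A₀ cd.p₀ cd.β₀ ((C P).flow.g k) :=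
  B16Sect1DisplaysPrinted.fund189_of h.displays

/-- **p. 387 l. 23–27, the improved (1.89) «with the additional term −κ₁d_k(X) in the exponential»** for the second operation family of
every step in the window, projected from the field `displays` (`B16Sect1DisplaysPrinted.coverage189_of`).
[cite: Balaban1989LargeFieldII, p.387 l.23-27 (bookkeeping)] -/
theorem Hyp.coverage189 (h : Hyp C Xs cs Xd Y cd κ₁) :
    ∃ γ : ℝ, 0 < γ ∧ ∀ P : B12.RunParams, (C P).flow.InInterval γ P.K → ∀ k, k ≤ P.K →
      ∀ Z V, (Y P k).T1' Z V ≤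
        Real.exp (-(2 * (1 + cd.β₀)⁻¹ * p0Profile cd.A₀ cd.p₀ ((C P).flow.g k)) - κ₁ * (Y P k).dk Z) :=
  B16Sect1DisplaysPrinted.coverage189_of h.displays

/-- **(1.100) p. 390** for the new 𝐑-terms of every step in the window, projected from the field `displays`
(`B16Sect1DisplaysPrinted.ineq1100_of`). [cite: Balaban1989LargeFieldII, (1.100) p.390 (bookkeeping)] -/
theorem Hyp.ineq1100 (h : Hyp C Xs cs Xd Y cd κ₁) :
    ∃ γ : ℝ, 0 < γ ∧ ∀ P : B12.RunParams, (C P).flow.InInterval γ P.K → ∀ k, k ≤ P.K →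
      B16.Ineq1100 (Xd P k).S (Xd P k).dom (Xd P k).R' (p0Profile cd.A₀ cd.p₀ ((C P).flow.g k)) cd.κ :=
  B16Sect1DisplaysPrinted.ineq1100_of h.displays

/-- **p. 355 «a sufficiently small positive γ», ONCE FOR THE WHOLE BLOCK**: one window ]0, γ] on which, for every run whose effective
couplings stay in it, the per-step factor sentences of pp. 380–383 hold at every step j < K, the displays (1.72)∕(1.79)∕p. 383∕(1.80)∕(1.89)∕
(1.97)∕(1.99)∕(1.100) and the coverage sentence of p. 387 hold at every k ≦ K, and the new action of every step k < K satisfies the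
induction hypothesis (kernel-checked `min` over the three windows of the fields; `B14Cor3.inInterval_of_le`).
[cite: Balaban1989LargeFieldII, Thm 1 p.355 with pp.380-391 (bookkeeping)] -/
theorem Hyp.atCommonWindow (h : Hyp C Xs cs Xd Y cd κ₁) :
    ∃ γ : ℝ, 0 < γ ∧ ∀ P : B12.RunParams, (C P).flow.InInterval γ P.K →
      (∀ j, j < P.K → B16StepFactorsPrinted.StepDisplaysAt (C P) j (Xs P j) cs) ∧
      (∀ k, k ≤ P.K → B16Sect1DisplaysPrinted.DisplaysAt (C P) k (Xd P k) cd ∧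
        B16Sect1DisplaysPrinted.Coverage (C P) k (Y P k) cd κ₁) ∧
      (∀ k, k < P.K → (C P).Sect2Form k → (C P).Sect2Form (k + 1)) := by
  obtain ⟨γ₁, hγ₁, H₁⟩ := h.stepFactors
  obtain ⟨γ₂, hγ₂, H₂⟩ := h.displays
  obtain ⟨γ₃, hγ₃, H₃⟩ := h.newAction
  refine ⟨min (min γ₁ γ₂) γ₃, lt_min (lt_min hγ₁ hγ₂) hγ₃, fun P hP => ⟨?_, ?_, ?_⟩⟩
  · exact H₁ P (B14Cor3.inInterval_of_le hP (le_trans (min_le_left _ _) (min_le_left _ _)))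
  · exact H₂ P (B14Cor3.inInterval_of_le hP (le_trans (min_le_left _ _) (min_le_right _ _)))
  · exact H₃ P (B14Cor3.inInterval_of_le hP (min_le_right _ _))

/-- **p. 391 l. 1–2 «This completes the proof of Theorem 1», located**: the bundle's induction step, together with the BASE of the
induction on k — [III] Thm 1 p. 262, *«ρ₀ = exp[−(1∕g₀²)A − E]»* (`B16.InductionBase`, the consumer's input at any window γ_b > 0; row of
block 34, not of this block) —, yields Theorem 1 p. 355 as typed (`B16.Thm1Printed`), by `B16.thm1_of_steps` at the common window
`min γ γ_b`. [cite: Balaban1989LargeFieldII, Thm 1 p.355 and p.391 l.1-2 (bookkeeping)] -/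
theorem Hyp.thm1_of_base (h : Hyp C Xs cs Xd Y cd κ₁) {γb : ℝ} (hγb : 0 < γb) (hb : B16.InductionBase C γb) :
    B16.Thm1Printed C := by
  obtain ⟨γ, hγ, hs⟩ := h.newAction
  refine B16.thm1_of_steps C (min γ γb) (lt_min hγ hγb) (fun P hP => ?_) (fun P hP k hk hk' => ?_)
  · exact hb P (B14Cor3.inInterval_of_le hP (min_le_right _ _))
  · exact hs P (B14Cor3.inInterval_of_le hP (min_le_left _ _)) k hk hk'

/-- **p. 387 l. 26–27 ∕ p. 391 l. 2 «hence Corollary 3», located**: with the base of the induction the bundle yields [III] Cor. 3 (2.50)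
as typed (`B16.Cor3_250`). [cite: Balaban1989LargeFieldII, Cor 3 p.387 and p.391 (bookkeeping)] -/
theorem Hyp.cor3_of_base (h : Hyp C Xs cs Xd Y cd κ₁) {γb : ℝ} (hγb : 0 < γb) (hb : B16.InductionBase C γb) :
    B16.Cor3_250 C :=
  h.cor3 (h.thm1_of_base hγb hb)

/-- **THE KEY's B16 CONJUNCT, MODULO THE BASE** — p. 391 l. 1–2 *«This completes the proof of Theorem 1 and Corollary 3»*, located as
the pinned end statement `B16.EndStatementBPrinted C = Thm1Printed C ∧ Cor3_250 C` (`B16.endStatementBPrinted_of_leaves`), from the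
bundle and the base of the induction ([III] Thm 1 p. 262).  Bookkeeping between hypothesis shapes; nothing of Bałaban's asserted; the K1⁷
item is NOT discharged by this (its record, provisos and window clauses are untouched, and `Hyp` is a hypothesis).
[cite: Balaban1989LargeFieldII, Thm 1 p.355, Cor 3 p.387, p.391 l.1-2 (bookkeeping)] -/
theorem Hyp.endStatementBPrinted_of_base (h : Hyp C Xs cs Xd Y cd κ₁) {γb : ℝ} (hγb : 0 < γb) (hb : B16.InductionBase C γb) :
    B16.EndStatementBPrinted C :=
  B16.endStatementBPrinted_of_leaves C (h.thm1_of_base hγb hb) h.cor3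

end Proj

/-- **Converse bookkeeping (honesty of the two theorem-level slots)**: the pinned end statement already contains the bundle's `newAction`
and `cor3` fields — Theorem 1 trivially contains its induction step at its own window (`B16.inductionStep_of_thm1With`) and Cor. 3 its
leaf —, so those two slots are Theorem 1's printed PROOF SHAPE and [III] Cor. 3's leaf, never claims stronger than the end statement.
[cite: Balaban1989LargeFieldII, Thm 1 p.355 and p.391 (bookkeeping)] -/
theorem newAction_cor3_of_endStatementBPrinted (C : B16.Construction) (h : B16.EndStatementBPrinted C) :
    (∃ γ : ℝ, 0 < γ ∧ B16.InductionBase C γ ∧ B16.InductionStep C γ) ∧ B16.Cor3Leaf C := by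
  obtain ⟨⟨γ, hγ, H⟩, hcor⟩ := h
  exact ⟨⟨γ, hγ, B16.inductionStep_of_thm1With C γ H⟩, fun _ => hcor⟩

/-- **The bundle from its four named parts** (the constructor, displayed for consumers who hold the siblings' claims separately).
[cite: Balaban1989LargeFieldII, pp.380-391 (bookkeeping)] -/
theorem hyp_of_parts (C : B16.Construction)
    (Xs : (P : B12.RunParams) → (j : ℕ) → B16StepFactorsPrinted.StepCarriers (C P) j) (cs : B16StepFactorsPrinted.Consts)
    (Xd : (P : B12.RunParams) → (k : ℕ) → B16Sect1DisplaysPrinted.StepCarriers (C P) k)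
    (Y : (P : B12.RunParams) → (k : ℕ) → B16Sect1DisplaysPrinted.CoverCarriers (C P) k)
    (cd : B16Sect1DisplaysPrinted.Consts) (κ₁ : ℝ)
    (h₁ : B16StepFactorsPrinted.StepFactorsPrinted C Xs cs) (h₂ : B16Sect1DisplaysPrinted.Sect1DisplaysPrinted C Xd Y cd κ₁)
    {γ : ℝ} (hγ : 0 < γ) (h₃ : B16.InductionStep C γ) (h₄ : B16.Cor3Leaf C) : Hyp C Xs cs Xd Y cd κ₁ :=
  ⟨h₁, h₂, ⟨γ, hγ, h₃⟩, h₄⟩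

end Literature.MathematicalPhysics.QuantumFieldTheory.Balaban1983to89.B16Carve40BoundsCor3Hyp
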